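import Summits.HodgeConjecture.HodgeConjecture.Theorems.VHCAbelianSchemesRoadNowhereDisplaceableDefs
import Summits.HodgeConjecture.HodgeConjecture.Theorems.VHCAbelianSchemesRoadIsogenyPushforwardExtAdjunctionVB
import Literature.AlgebraicGeometry.Modules.PullbackPushforwardDerivedAdjunction
import Literature.AlgebraicGeometry.Modules.PushforwardLinear
import Literature.AlgebraicGeometry.Motives.AbelianVarietyTranslationInvariantAmple
import HarnessLib

/-!
# Road №4 (`VHCAbelianSchemesRoad`), crux stmt-HodgeConjecture-26512 `DiagLocalOfMarkmanPinnedForall` — lens line N′ «nowhere-displaceable»,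
# brick toward (N-F) `extJumpLocus_lifts`: JUMPS LIFT ALONG `q` AS SOON AS `E•` IS A RETRACT OF `q_*q^*E•`

research route conditional on HC_CM; not a corollary; Q11.4-sentence-2 already refuted in dim ≥ 3.

(N-F) (`Cruxes/DiagLocalOfMarkmanPinnedForall/Lines/NowhereDisplaceable.lean` c9299650b742f1b3 l.271) says: for a bounded complex of vector bundles
`E•` on the secant quotient `Y = (J × Ĵ)∕Ḡ` and `p ∈ (J × Ĵ)(ℂ)` with `q(p)` in the Ext-jump locus of `E•`, the point `p` lies in the Ext-jump locus
of `q^*E•`. THIS FILE proves it from ONE displayed input, the RETRACT PROPERTY (R): «every bounded complex of vector bundles `E•` on `Y` is a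
retract of `q_*•q^*•E•` as a complex» (`∃ i r, i ≫ r = 𝟙`; on paper `i = η` the unit and `r = (deg q)⁻¹ · (trace ⊗ 𝟙)` through the projection
formula `q_*q^*E ≅ E ⊗ q_*𝒪`, Stacks 0BVH — NOT in the tree: the tree has the trace only on `𝒪`, `Modules/PushforwardTrace`). Everything else IS in
the tree and is used here: the derived adjunction `Hom_{D(P)}(Q q^*M•, (Q L•)⟦k⟧) ≃ₗ[ℂ] Hom_{D(Y)}(Q M•, (Q q_*L•)⟦k⟧)` along the AFFINE `q` for
vector-bundle complexes (`Modules.shiftedHomLinearEquivPullbackPushforwardOfVectorBundles`, K-injective route, no flatness), the pseudo-functoriality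
`τ_p^* q^* ≅ q^* τ_{q(p)}^*` of Mathlib's `Scheme.Modules.pullbackComp ∕ pullbackCongr` over `τ_p ≫ q = q ≫ τ_{q(p)}` (`AbelianVariety.translation_comp_hom`),
and `IsBoundedVBComplex.pullback`.

PROOF. `q(p) ∈ J(E•)` gives `φ ≠ 0 : Q(τ_{q p}^*E•) ⟶ (Q E•)⟦k⟧`; `φ ≫ (Q i)⟦k⟧ ≠ 0` because `(Q i)⟦k⟧ ≫ (Q r)⟦k⟧ = 𝟙`; the INVERSE of the derived
adjunction (at `M• := τ_{q p}^*E•`, `L• := q^*E•`) sends it to a non-zero class `Q(q^*τ_{q p}^*E•) ⟶ (Q q^*E•)⟦k⟧` (a linear equivalence), and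
precomposing with the isomorphism `Q(τ_p^*q^*E•) ≅ Q(q^*τ_{q p}^*E•)` keeps it non-zero: `p ∈ J(q^*E•)`.

* `extJumpLocus_lifts_of_retract` — **(R) → (N-F)** with (N-F) stated VERBATIM (l.272–274 over the re-homed `quotientPullbackComplex`).

So (N-F) = (R) exactly, in the kernel; (R) is Stacks 0BVH + the projection formula for finite locally free `q` — library debt, TRUE, not typed as a
named fact here (it enters as the binder `hret`). NOTHING here says (R), (N-F), (N-U), (S4), the crux, №4, HC_AV, HC_CM or HC holds; HC_CM HELD, by name
only; typed ≠ proved. No `sorry`, no named fact. [cite: Mukai1978, §3] [cite: MumfordAV1970, §7 Thm. 4 (p. 72)] [cite: StacksProject, Tag 0BVH and Tag 0DVC]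
[cite: Lipman2009, Prop. 3.2.3]
-/

noncomputable section

-- `TopCat.Presheaf`/`Scheme.Modules` are not reducible (as in Mathlib's `AlgebraicGeometry/Modules/Sheaf.lean`).
set_option backward.isDefEq.respectTransparency false

open CategoryTheory CategoryTheory.Category CategoryTheory.Limits AlgebraicGeometry
open DerivedCategory

namespace Summit.HodgeConjecture.HodgeConjecture.Ring2.SemiregularRepresentatives

set_option linter.dupNamespace false -- the cell's namespace repeats the summit name, as in every `Ring2*` file

namespace NowhereDisplaceable

open Literature.AlgebraicGeometry Literature.AlgebraicGeometry.Motives Literature.AlgebraicGeometry.Motives.AbelianVariety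
open Literature.AlgebraicGeometry.KTheory Literature.AlgebraicGeometry.Modules
open Summit.HodgeConjecture.HodgeConjecture.Ring2.SemiregularRepresentatives.MoverTrap

/-- **`τ_p^* q^* ≅ q^* τ_{q(p)}^*` on complexes** (`τ_p ≫ q = q ≫ τ_{q(p)}` for the homomorphism `q`, and Mathlib's pseudo-functoriality of `Scheme.Modules.pullback`).
[cite: MumfordAV1970, §4 and §7 Thm. 4 (p. 72)] -/
theorem nonempty_quotientPullback_translationPullback_iso (D : SecantQuotientDatum) (p : D.P.Points ℂ)
    (E : CochainComplex D.Y.X.left.Modules ℤ) :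
    Nonempty (quotientPullbackComplex D (translationPullbackComplex D.Y (AlgPoints.map D.q.hom.hom.hom p) E) ≅
      translationPullbackComplex D.P p (quotientPullbackComplex D E)) := by
  -- `τ_p ≫ q = q ≫ τ_{q p}` on underlying schemes
  have h : Hom.toSchemeHom D.q ≫ (D.Y.translation (AlgPoints.map D.q.hom.hom.hom p)).left =
      (D.P.translation p).left ≫ Hom.toSchemeHom D.q := by
    change D.q.hom.hom.hom.left ≫ (D.Y.translation (p ≫ D.q.hom.hom.hom)).left = (D.P.translation p).left ≫ D.q.hom.hom.hom.left
    rw [← Over.comp_left, ← Over.comp_left, translation_comp_hom]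
  let Φ : Scheme.Modules.pullback (D.Y.translation (AlgPoints.map D.q.hom.hom.hom p)).left ⋙ Scheme.Modules.pullback (Hom.toSchemeHom D.q) ≅
      Scheme.Modules.pullback (Hom.toSchemeHom D.q) ⋙ Scheme.Modules.pullback (D.P.translation p).left :=
    Scheme.Modules.pullbackComp _ _ ≪≫ Scheme.Modules.pullbackCongr h ≪≫ (Scheme.Modules.pullbackComp _ _).symm
  exact ⟨(NatIso.mapHomologicalComplex Φ (ComplexShape.up ℤ)).app E⟩

/-- **(R) → (N-F): JUMPS LIFT ALONG `q` as soon as every bounded vector-bundle complex on `Y` is a retract of `q_*•q^*•`** — the conclusion is (N-F)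
`stub_extJumpLocus_lifts` VERBATIM (workfile c9299650b742f1b3 l.272–274 over `…NowhereDisplaceableDefs`). [cite: Mukai1978, §3] [cite: StacksProject, Tag 0BVH and Tag 0DVC]
[cite: Lipman2009, Prop. 3.2.3] -/
theorem extJumpLocus_lifts_of_retract
    (hret : ∀ (D : SecantQuotientDatum) (E : CochainComplex D.Y.X.left.Modules ℤ), IsBoundedVBComplex E →
      ∃ (i : E ⟶ ((Scheme.Modules.pushforward (Hom.toSchemeHom D.q)).mapHomologicalComplex (ComplexShape.up ℤ)).obj (quotientPullbackComplex D E))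
        (r : ((Scheme.Modules.pushforward (Hom.toSchemeHom D.q)).mapHomologicalComplex (ComplexShape.up ℤ)).obj (quotientPullbackComplex D E) ⟶ E),
        i ≫ r = 𝟙 E) :
    ∀ (D : SecantQuotientDatum) (E : CochainComplex D.Y.X.left.Modules ℤ), IsBoundedVBComplex E →
      ∀ p : D.P.Points ℂ, AlgPoints.map D.q.hom.hom.hom p ∈ extJumpLocus D.Y E →
        p ∈ extJumpLocus D.P (quotientPullbackComplex D E) := by
  intro D E hE p hp
  letI := HasDerivedCategory.standard D.Y.X.left.Modules
  letI := HasDerivedCategory.standard D.P.X.left.Modules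
  obtain ⟨k, hk⟩ := hp
  refine ⟨k, ?_⟩
  -- a non-zero class downstairs
  rw [not_subsingleton_iff_nontrivial] at hk
  obtain ⟨φ, hφ⟩ := exists_ne (0 : ShiftedHom (Q.obj (translationPullbackComplex D.Y (AlgPoints.map D.q.hom.hom.hom p) E)) (Q.obj E) k)
  -- push it into `q_*q^*E` along the retract
  obtain ⟨i, r, hir⟩ := hret D E hE
  set ψ : ShiftedHom (Q.obj (translationPullbackComplex D.Y (AlgPoints.map D.q.hom.hom.hom p) E))
      (Q.obj (((Scheme.Modules.pushforward (Hom.toSchemeHom D.q)).mapHomologicalComplex (ComplexShape.up ℤ)).obj (quotientPullbackComplex D E))) k :=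
    φ ≫ (Q.map i)⟦k⟧' with hψdef
  have hψ : ψ ≠ 0 := by
    intro h0
    apply hφ
    have hback : ψ ≫ (Q.map r)⟦k⟧' = φ := by
      rw [hψdef, assoc, ← Functor.map_comp, ← Functor.map_comp, hir, CategoryTheory.Functor.map_id, CategoryTheory.Functor.map_id, comp_id]
    rw [← hback, h0, zero_comp]
  -- the derived adjunction along the affine `q`
  haveI : IsFinite (Hom.toSchemeHom D.q) := D.isIsogeny_q.2
  haveI : (Scheme.Modules.pushforward (Hom.toSchemeHom D.q)).Linear ℂ := linear_pushforward D.q.hom.hom.hom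
  have hM : IsBoundedVBComplex (translationPullbackComplex D.Y (AlgPoints.map D.q.hom.hom.hom p) E) := hE.pullback _
  have hL : IsBoundedVBComplex (quotientPullbackComplex D E) := hE.pullback _
  obtain ⟨a₀, b₀, hMa, hMb⟩ := IsBoundedVBComplex.exists_bounds hM
  obtain ⟨a, _, hLa, _⟩ := IsBoundedVBComplex.exists_bounds hL
  let Ψ := shiftedHomLinearEquivPullbackPushforwardOfVectorBundles (𝕜 := ℂ) (Hom.toSchemeHom D.q)
    (translationPullbackComplex D.Y (AlgPoints.map D.q.hom.hom.hom p) E) a₀ b₀ hMa hMb hM.isFiniteLocallyFree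
    (quotientPullbackComplex D E) a hLa hL.isFiniteLocallyFree k
  have hχ : Ψ.symm ψ ≠ 0 := by
    intro h0
    apply hψ
    have := congrArg Ψ h0
    rwa [LinearEquiv.apply_symm_apply, map_zero] at this
  -- transport along `τ_p^* q^* ≅ q^* τ_{q p}^*`
  obtain ⟨e⟩ := nonempty_quotientPullback_translationPullback_iso D p E
  intro hsub
  apply hχ
  have hzero : Q.map e.inv ≫ Ψ.symm ψ = 0 := Subsingleton.elim _ _
  calc Ψ.symm ψ = Q.map e.hom ≫ Q.map e.inv ≫ Ψ.symm ψ := by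
        rw [← assoc, ← Functor.map_comp, Iso.hom_inv_id, CategoryTheory.Functor.map_id, id_comp]
    _ = 0 := by rw [hzero, comp_zero]

end NowhereDisplaceable

end Summit.HodgeConjecture.HodgeConjecture.Ring2.SemiregularRepresentatives
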